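import Literature.NumberTheory.EllipticCurves.BinaryQuarticMinimisation
import Literature.NumberTheory.EllipticCurves.BhargavaShankarCountingProofs
import Literature.NumberTheory.EllipticCurves.BinaryQuarticTwoCoveringsSurjective
import HarnessLib

/-!
# Bhargava–Shankar, Theorem 5.6 (the `2`-Selmer parametrization) assembled from its printed
# inputs: the Birch–Swinnerton-Dyer correspondence and the minimisation lemmas

`Proofs` companion of `Literature/NumberTheory/EllipticCurves/BinaryQuarticMinimisation.lean`
(third layer of the decomposition of the named fact
`Literature.NumberTheory.EllipticCurves.averageRankLE_three_halves`, `BSDWave0.lean`, bsd.S26).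

Source and numbering: M. Bhargava, A. Shankar, *Binary quartic forms having bounded invariants,
and the boundedness of the average rank of elliptic curves*, Ann. of Math. (2) 181 (2015) 191–242
= arXiv:1006.1002; lemma, theorem and page numbers are those of the held arXiv text
(`arXiv:1006.1002v2` numbering, §5.1 "`2`-Selmer groups and locally soluble binary quartic
forms"; §3 of the published version), as in the statement file.

## The printed proof of Theorem 5.6 (held text, p. 32) and its formalisation

Theorem 5.6: for `E = E_{A,B}` in the height family, the elements of `S₂(E)` correspond to the
`PGL₂(ℚ)`-classes of locally soluble integral binary quartic forms with invariants `2⁴I(E)`,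
`2⁶J(E)` (`I(E) = −3A`, `J(E) = −27B`). The text derives it from

* Lemma 5.2 + the remark after the definition of local solubility (p. 31): `S₂(E)` corresponds to
  the (`ℚ`-)equivalence classes of locally soluble integral forms with invariants `λ⁴I(E)`,
  `λ⁶J(E)` for some `λ ∈ ℚˣ` — the named fact
  `bhargavaShankar_card_selmerTwo_eq_kEquivClassCount` (hypothesis `h52` below);
* Lemmas 5.3, 5.4, 5.5 (= Birch–Swinnerton-Dyer 1963, Lemmas 3, 4, 5): minimisation at `p ≥ 5`,
  at `3`, at `2` — the named facts `bsd_minimisation_prime_five_le`, `bsd_minimisation_three`,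
  `bsd_minimisation_two` (hypotheses `h53`, `h54`, `h55`),

by the following argument, which is what this file proves (sorry-free):

1. (`exists_kEquiv_invariants`) every locally soluble integral form `f` with invariants
   `λ⁴I(E)`, `λ⁶J(E)`, `λ = n/q ∈ ℚˣ`, is equivalent to a locally soluble integral form with
   invariants exactly `2⁴I(E)`, `2⁶J(E)`: replace `f` by `q²f` (now `λ = n ∈ ℤ ∖ {0}`, and only
   `|n|` matters); remove the odd prime factors of `n` one at a time by Lemma 5.3 (`p ≥ 5`:
   `p⁴ ∣ I(f) = n⁴I(E)`, `p⁶ ∣ J(f)`) and Lemma 5.4 (`p = 3`: `3⁵ ∣ n⁴ · (−3A)`, `3⁹ ∣ n⁶ · (−27B)`)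
   (`exists_kEquiv_odd`, induction on the odd part of `n`); then adjust the power of `2`
   (`exists_kEquiv_twoPow`): from `n = 1` go up by the substitution `diag(2, 1)`, from `n = 2^k`,
   `k ≥ 2`, go down by Lemma 5.5 (`2⁶ ∣ 2^{4k}I(E)`, `2⁹ ∣ 2^{6k}J(E)`, `2¹⁰ ∣ 8I + J`). Local
   solubility is carried along equivalences (`KEquiv.isLocallySoluble_iff`).
2. (`KEquiv.pgl2Equiv_of_I_eq_of_J_eq`) "two integral binary quartic forms having the same
   invariants are equivalent if and only if they are `PGL₂(ℚ)`-equivalent" (p. 32, end of the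
   proof): if `g = μ²(γ · f)` with `I(g) = I(f)`, `J(g) = J(f)` not both zero, then `t = μ det γ`
   has `t⁴ = 1` or `t⁶ = 1`, so `t² = 1` over `ℚ` and `g = det(γ)⁻²(γ · f)`. (For the forms of
   Thm 5.6, `(I, J) ≠ (0, 0)` because `4A³ + 27B² ≠ 0`.)
3. (`kEquivClassCount_eq_pgl2QClassCount`) hence `T ↦ T ∩ S` (with `S` the set of forms with
   invariants exactly `2⁴I(E)`, `2⁶J(E)`) is a bijection from the equivalence classes of the
   larger set onto the `PGL₂(ℚ)`-classes of `S`, and the two class counts agree; with Lemma 5.2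
   this is Theorem 5.6 (`bhargavaShankar_card_selmerTwo_eq_of_facts`).

Consequently (`averageRankLE_three_halves_of_BSD_facts`) Cor. 1.2
(`averageRankLE_three_halves`) holds granted Lemma 5.2, Lemmas 5.3–5.5, eq. (31) and Prop. 5.8,
all other steps of the paper's argument being proved in the tree
(`BhargavaShankarCountingProofs`, `BSDWave0Proofs`).

## Design

* Theorems only; no statement file is touched. `noncomputable section`, `open scoped Classical`
  as in the files served. Dot-notation API for `KEquiv` lives in
  `namespace Literature.NumberTheory.EllipticCurves.BinaryQuartic` next to `PGL2Equiv.refl` etc.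

## References

* M. Bhargava, A. Shankar, Ann. of Math. (2) 181 (2015) 191–242 = arXiv:1006.1002, §5.1:
  Lemma 5.2, Lemmas 5.3–5.5, Theorem 5.6 and its proof (p. 32 of the held text).
  [cite: BhargavaShankarAnnals2015, Thm 5.6 (arXiv:1006.1002v2 numbering; §5.1)]
* B. J. Birch, H. P. F. Swinnerton-Dyer, *Notes on elliptic curves. I*, J. reine angew. Math. 212
  (1963) 7–25, Lemmas 3–5 (quoted through Bhargava–Shankar).
-/

noncomputable section

open scoped Classical

namespace Literature.NumberTheory.EllipticCurves

namespace BinaryQuartic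

/-! ## §1 `K`-equivalence: an equivalence relation, functorial, preserving solubility -/

section CommRing

variable {R S : Type*} [CommRing R] [CommRing S]

/-- An integral form mapped to a field of characteristic zero factors through `ℚ`. [folklore] -/
theorem map_intCast (K : Type*) [Field K] [CharZero K] (f : BinaryQuartic ℤ) :
    f.map (Int.castRingHom K) = (f.map (Int.castRingHom ℚ)).map (Rat.castHom K) := by
  rw [map_map', RingHom.ext_int ((Rat.castHom K).comp (Int.castRingHom ℚ)) (Int.castRingHom K)]

/-- The determinant of a mapped matrix. [folklore] -/
theorem det_map_ringHom (φ : R →+* S) (γ : Matrix (Fin 2) (Fin 2) R) :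
    (γ.map φ).det = φ γ.det := by
  rw [← RingHom.mapMatrix_apply, ← RingHom.map_det]

end CommRing

section Field

variable {K L : Type*} [Field K] [Field L]

/-- `K`-equivalence is reflexive. [folklore] -/
theorem KEquiv.refl (f : BinaryQuartic K) : KEquiv f f :=
  ⟨1, one_ne_zero, 1, by simp, by simp⟩

/-- `K`-equivalence is transitive. [folklore] -/
theorem KEquiv.trans {f g h : BinaryQuartic K} (h₁ : KEquiv f g) (h₂ : KEquiv g h) :
    KEquiv f h := by
  obtain ⟨μ₁, hμ₁, γ₁, hγ₁, rfl⟩ := h₁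
  obtain ⟨μ₂, hμ₂, γ₂, hγ₂, rfl⟩ := h₂
  refine ⟨μ₂ * μ₁, mul_ne_zero hμ₂ hμ₁, γ₂ * γ₁,
    by rw [Matrix.det_mul]; exact mul_ne_zero hγ₂ hγ₁, ?_⟩
  rw [smul_subst, smul_smul, subst_mul, mul_pow]

/-- `K`-equivalence is an equivalence relation (Bhargava–Shankar, held text §5.1); symmetry is
`TwoCovering.kEquiv_symm` (`BinaryQuarticTwoCoveringsSelmerMap`).
[cite: BhargavaShankarAnnals2015, §5.1 (K-equivalence; arXiv:1006.1002v2 numbering)] -/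
theorem KEquiv.equivalence : Equivalence (KEquiv (K := K)) :=
  ⟨KEquiv.refl, TwoCovering.kEquiv_symm, KEquiv.trans⟩

/-- Invariants of `K`-equivalent forms differ by `s⁴`, `s⁶` for a common `s ∈ Kˣ`
(`s = μ det γ`). [folklore] -/
theorem KEquiv.exists_invariants_eq {f g : BinaryQuartic K} (h : KEquiv f g) :
    ∃ s : K, s ≠ 0 ∧ g.I = s ^ 4 * f.I ∧ g.J = s ^ 6 * f.J := by
  obtain ⟨μ, hμ, γ, hγ, rfl⟩ := h
  refine ⟨μ * γ.det, mul_ne_zero hμ hγ, ?_, ?_⟩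
  · rw [I_smul, I_subst]; ring
  · rw [J_smul, J_subst]; ring

/-- `K`-equivalence is functorial in field homomorphisms. [folklore] -/
theorem KEquiv.map (ψ : K →+* L) {f g : BinaryQuartic K} (h : KEquiv f g) :
    KEquiv (f.map ψ) (g.map ψ) := by
  obtain ⟨μ, hμ, γ, hγ, rfl⟩ := h
  refine ⟨ψ μ, (map_ne_zero ψ).mpr hμ, γ.map ψ, ?_, ?_⟩
  · rw [det_map_ringHom]; exact (map_ne_zero ψ).mpr hγ
  · rw [TwoCovering.map_smul_form, map_pow, map_subst]

/-- `K`-equivalent forms are simultaneously `K`-soluble. [folklore] -/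
theorem KEquiv.isSoluble_iff {f g : BinaryQuartic K} (h : KEquiv f g) :
    g.IsSoluble ↔ f.IsSoluble := by
  obtain ⟨μ, hμ, γ, hγ, rfl⟩ := h
  rw [isSoluble_smul_sq_iff _ hμ, isSoluble_subst_iff _ hγ]

/-- Equivalent integral forms are simultaneously locally soluble (Bhargava–Shankar, held text
§5.1: local solubility is a property of equivalence classes). [cite: BhargavaShankarAnnals2015, §5.1 (arXiv:1006.1002v2 numbering)] -/
theorem KEquiv.isLocallySoluble_iff {f g : BinaryQuartic ℤ}
    (h : KEquiv (f.map (Int.castRingHom ℚ)) (g.map (Int.castRingHom ℚ))) :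
    g.IsLocallySoluble ↔ f.IsLocallySoluble := by
  unfold IsLocallySoluble
  refine and_congr ?_ (forall_congr' fun p ↦ forall_congr' fun _ ↦ ?_)
  · rw [map_intCast ℝ f, map_intCast ℝ g]
    exact (h.map _).isSoluble_iff
  · rw [map_intCast ℚ_[p] f, map_intCast ℚ_[p] g]
    exact (h.map _).isSoluble_iff

/-! ## §2 Forms with the same invariants: equivalence is `PGL₂(ℚ)`-equivalence -/

/-- **"Two integral binary quartic forms having the same invariants are equivalent if and only if
they are `PGL₂(ℚ)`-equivalent"** (Bhargava–Shankar, held text p. 32, end of the proof of Thm 5.6),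
the nontrivial direction, for forms over `ℚ` with `(I, J) ≠ (0, 0)`: if `g = μ²(γ · f)` has the
same invariants as `f` then `(μ det γ)⁴ = 1` or `(μ det γ)⁶ = 1`, so `(μ det γ)² = 1` in `ℚ` and
`g = det(γ)⁻²(γ · f)`. (The converse is `PGL2Equiv.kEquiv`.)
[cite: BhargavaShankarAnnals2015, Thm 5.6 (proof, p. 32; arXiv:1006.1002v2 numbering)] -/
theorem KEquiv.pgl2Equiv_of_I_eq_of_J_eq {f g : BinaryQuartic ℚ} (h : KEquiv f g)
    (hI : g.I = f.I) (hJ : g.J = f.J) (h0 : f.I ≠ 0 ∨ f.J ≠ 0) : PGL2Equiv f g := by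
  obtain ⟨μ, hμ, γ, hγ, rfl⟩ := h
  rw [I_smul, I_subst] at hI
  rw [J_smul, J_subst] at hJ
  have h2 : (0 : ℚ) ≤ (μ * γ.det) ^ 2 := sq_nonneg _
  have ht : (μ * γ.det) ^ 2 = 1 := by
    rcases h0 with hI0 | hJ0
    · have h4 : ((μ * γ.det) ^ 2) ^ 2 = 1 := by
        apply mul_right_cancel₀ hI0
        linear_combination hI
      exact (pow_eq_one_iff_of_nonneg h2 two_ne_zero).mp h4
    · have h6 : ((μ * γ.det) ^ 2) ^ 3 = 1 := by
        apply mul_right_cancel₀ hJ0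
        linear_combination hJ
      exact (pow_eq_one_iff_of_nonneg h2 (by norm_num)).mp h6
  refine ⟨γ, hγ, ?_⟩
  congr 1
  field_simp
  linear_combination ht

/-- For forms over `ℚ` with the same invariants `(I, J) ≠ (0, 0)`, equivalence and
`PGL₂(ℚ)`-equivalence coincide (Bhargava–Shankar, held text p. 32).
[cite: BhargavaShankarAnnals2015, Thm 5.6 (proof, p. 32; arXiv:1006.1002v2 numbering)] -/
theorem kEquiv_iff_pgl2Equiv_of_I_eq_of_J_eq {f g : BinaryQuartic ℚ} (hI : g.I = f.I)
    (hJ : g.J = f.J) (h0 : f.I ≠ 0 ∨ f.J ≠ 0) : KEquiv f g ↔ PGL2Equiv f g :=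
  ⟨fun h ↦ h.pgl2Equiv_of_I_eq_of_J_eq hI hJ h0, PGL2Equiv.kEquiv⟩

end Field

/-! ## §3 Minimisation: from invariants `λ⁴I(E)`, `λ⁶J(E)` to exactly `2⁴I(E)`, `2⁶J(E)` -/

section Minimisation

/-- The power of `2` (Bhargava–Shankar, held text p. 32: "use Lemma 5.5 if needed (multiple
times if necessary)"; going up from `λ = 1` to `λ = 2` is the integral substitution `diag(2,1)`):
a locally soluble integral form with invariants `2^{4k}I(E)`, `2^{6k}J(E)` is equivalent to one
with invariants `2⁴I(E)`, `2⁶J(E)`, granted Lemma 5.5 (hypothesis `h55`).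
[cite: BhargavaShankarAnnals2015, Thm 5.6 (proof, p. 32; arXiv:1006.1002v2 numbering)] -/
theorem exists_kEquiv_twoPow (h55 : bsd_minimisation_two) (A B : ℤ) :
    ∀ (k : ℕ) (f : BinaryQuartic ℤ), f.IsLocallySoluble →
      f.I = ((2 : ℤ) ^ k) ^ 4 * (-3 * A) → f.J = ((2 : ℤ) ^ k) ^ 6 * (-27 * B) →
      ∃ f' : BinaryQuartic ℤ, KEquiv (f.map (Int.castRingHom ℚ)) (f'.map (Int.castRingHom ℚ)) ∧
        f'.I = 2 ^ 4 * (-3 * A) ∧ f'.J = 2 ^ 6 * (-27 * B) := by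
  intro k
  induction k using Nat.strong_induction_on with
  | _ k ih =>
  intro f hf hI hJ
  rcases k with _ | _ | j
  · -- `λ = 1`: go up by the integral substitution `γ = diag(2, 1)`, `det γ = 2`
    have hdet : (!![2, 0; 0, 1] : Matrix (Fin 2) (Fin 2) ℤ).det = 2 := by
      rw [Matrix.det_fin_two_of]; norm_num
    refine ⟨f.subst !![2, 0; 0, 1], ?_, ?_, ?_⟩
    · refine ⟨1, one_ne_zero, (!![2, 0; 0, 1] : Matrix (Fin 2) (Fin 2) ℤ).map (Int.castRingHom ℚ),
        ?_, ?_⟩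
      · rw [det_map_ringHom, hdet]; norm_num
      · rw [one_pow, one_smul, map_subst]
    · rw [I_subst, hI, hdet]; ring
    · rw [J_subst, hJ, hdet]; ring
  · -- `λ = 2`: nothing to do
    exact ⟨f, KEquiv.refl _, by rw [hI]; ring, by rw [hJ]; ring⟩
  · -- `λ = 2^(j+2)`: go down by Lemma 5.5
    have h6 : (2 : ℤ) ^ 6 ∣ f.I := ⟨2 ^ (4 * j + 2) * (-3 * A), by rw [hI]; ring⟩
    have h9 : (2 : ℤ) ^ 9 ∣ f.J := ⟨2 ^ (6 * j + 3) * (-27 * B), by rw [hJ]; ring⟩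
    have h10 : (2 : ℤ) ^ 10 ∣ 8 * f.I + f.J :=
      ⟨2 ^ (4 * j + 1) * (-3 * A) + 2 ^ (6 * j + 2) * (-27 * B), by rw [hI, hJ]; ring⟩
    haveI : Fact (Nat.Prime 2) := ⟨Nat.prime_two⟩
    obtain ⟨g, hK, hgI, hgJ⟩ := h55 f h6 h9 h10 (hf.2 2)
    have hg : g.IsLocallySoluble := (KEquiv.isLocallySoluble_iff hK).mpr hf
    have hgI' : g.I = ((2 : ℤ) ^ (j + 1)) ^ 4 * (-3 * A) := by
      apply mul_left_cancel₀ (pow_ne_zero 4 (two_ne_zero : (2 : ℤ) ≠ 0))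
      rw [hgI, hI]; ring
    have hgJ' : g.J = ((2 : ℤ) ^ (j + 1)) ^ 6 * (-27 * B) := by
      apply mul_left_cancel₀ (pow_ne_zero 6 (two_ne_zero : (2 : ℤ) ≠ 0))
      rw [hgJ, hJ]; ring
    obtain ⟨f', hK', hI', hJ'⟩ := ih (j + 1) (by omega) g hg hgI' hgJ'
    exact ⟨f', hK.trans hK', hI', hJ'⟩

/-- One odd prime (Bhargava–Shankar, held text p. 32: "by Lemma 5.3 […] for all primes `p ≥ 5`"
and "we can also get rid of the factor of 3 by using Lemma 5.4"): if `p` is an odd prime and `f`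
is a locally soluble integral form with invariants `(pc)⁴I(E)`, `(pc)⁶J(E)` (`I(E) = −3A`,
`J(E) = −27B`), then `f` is equivalent to an integral form with invariants `c⁴I(E)`, `c⁶J(E)`,
granted Lemmas 5.3 and 5.4 (hypotheses `h53`, `h54`).
[cite: BhargavaShankarAnnals2015, Thm 5.6 (proof, p. 32; arXiv:1006.1002v2 numbering)] -/
theorem exists_kEquiv_oddPrime (h53 : bsd_minimisation_prime_five_le)
    (h54 : bsd_minimisation_three) {A B c : ℤ} {p : ℕ} (hp : p.Prime) (hp2 : p ≠ 2)
    {f : BinaryQuartic ℤ} (hf : f.IsLocallySoluble) (hI : f.I = ((p : ℤ) * c) ^ 4 * (-3 * A))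
    (hJ : f.J = ((p : ℤ) * c) ^ 6 * (-27 * B)) :
    ∃ g : BinaryQuartic ℤ, KEquiv (f.map (Int.castRingHom ℚ)) (g.map (Int.castRingHom ℚ)) ∧
      g.IsLocallySoluble ∧ g.I = c ^ 4 * (-3 * A) ∧ g.J = c ^ 6 * (-27 * B) := by
  haveI : Fact p.Prime := ⟨hp⟩
  -- the common output of Lemma 5.3 (`p ≥ 5`) and Lemma 5.4 (`p = 3`)
  have key : ∃ g : BinaryQuartic ℤ,
      KEquiv (f.map (Int.castRingHom ℚ)) (g.map (Int.castRingHom ℚ)) ∧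
        (p : ℤ) ^ 4 * g.I = f.I ∧ (p : ℤ) ^ 6 * g.J = f.J := by
    obtain hp3 | hp5 : p = 3 ∨ 5 ≤ p := by
      rcases Nat.lt_or_ge p 5 with h | h
      · have h2 := hp.two_le
        interval_cases p
        · exact absurd rfl hp2
        · exact Or.inl rfl
        · exact absurd hp (by decide)
      · exact Or.inr h
    · subst hp3
      have h5 : (3 : ℤ) ^ 5 ∣ f.I := ⟨-(c ^ 4 * A), by rw [hI]; push_cast; ring⟩
      have h9 : (3 : ℤ) ^ 9 ∣ f.J := ⟨-(c ^ 6 * B), by rw [hJ]; push_cast; ring⟩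
      obtain ⟨g, hK, hgI, hgJ⟩ := h54 f h5 h9 (hf.2 3)
      exact ⟨g, hK, by exact_mod_cast hgI, by exact_mod_cast hgJ⟩
    · have h4 : (p : ℤ) ^ 4 ∣ f.I := ⟨c ^ 4 * (-3 * A), by rw [hI]; ring⟩
      have h6 : (p : ℤ) ^ 6 ∣ f.J := ⟨c ^ 6 * (-27 * B), by rw [hJ]; ring⟩
      exact h53 p hp5 f h4 h6 (hf.2 p)
  obtain ⟨g, hK, hgI, hgJ⟩ := key
  have hp0 : (p : ℤ) ≠ 0 := Int.natCast_ne_zero.mpr hp.ne_zero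
  refine ⟨g, hK, (KEquiv.isLocallySoluble_iff hK).mpr hf, ?_, ?_⟩
  · apply mul_left_cancel₀ (pow_ne_zero 4 hp0)
    rw [hgI, hI]; ring
  · apply mul_left_cancel₀ (pow_ne_zero 6 hp0)
    rw [hgJ, hJ]; ring

/-- The odd part (Bhargava–Shankar, held text p. 32): a locally soluble integral form with
invariants `(cm)⁴I(E)`, `(cm)⁶J(E)`, `m` odd, is equivalent to a locally soluble integral form
with invariants `c⁴I(E)`, `c⁶J(E)`, granted Lemmas 5.3 and 5.4 — remove the prime factors of `m`
one at a time (`exists_kEquiv_oddPrime`).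
[cite: BhargavaShankarAnnals2015, Thm 5.6 (proof, p. 32; arXiv:1006.1002v2 numbering)] -/
theorem exists_kEquiv_odd (h53 : bsd_minimisation_prime_five_le) (h54 : bsd_minimisation_three)
    (A B c : ℤ) :
    ∀ m : ℕ, Odd m → ∀ f : BinaryQuartic ℤ, f.IsLocallySoluble →
      f.I = (c * m) ^ 4 * (-3 * A) → f.J = (c * m) ^ 6 * (-27 * B) →
      ∃ g : BinaryQuartic ℤ, KEquiv (f.map (Int.castRingHom ℚ)) (g.map (Int.castRingHom ℚ)) ∧
        g.IsLocallySoluble ∧ g.I = c ^ 4 * (-3 * A) ∧ g.J = c ^ 6 * (-27 * B) := by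
  intro m
  induction m using Nat.strong_induction_on with
  | _ m ih =>
  intro hm f hf hI hJ
  by_cases h1 : m = 1
  · subst h1
    exact ⟨f, KEquiv.refl _, hf, by rw [hI]; push_cast; ring, by rw [hJ]; push_cast; ring⟩
  · have hm0 : m ≠ 0 := by rintro rfl; exact (Nat.not_odd_zero hm).elim
    set p := m.minFac with hp_def
    have hp : p.Prime := Nat.minFac_prime h1
    obtain ⟨m', hm'⟩ : p ∣ m := Nat.minFac_dvd m
    have hp2 : p ≠ 2 := by
      rintro h2
      exact (Nat.not_even_iff_odd.mpr hm) (even_iff_two_dvd.mpr (h2 ▸ ⟨m', hm'⟩))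
    have hpm : Odd (p * m') := by rw [← hm']; exact hm
    have hm'odd : Odd m' := Nat.Odd.of_mul_right hpm
    have hm'0 : 0 < m' := Nat.pos_of_ne_zero (by rintro rfl; exact hm0 (by rw [hm', mul_zero]))
    have hlt : m' < m := by
      rw [hm']; exact lt_mul_of_one_lt_left hm'0 hp.one_lt
    -- remove the prime `p` (odd: `p = 3` or `p ≥ 5`)
    have hI' : f.I = ((p : ℤ) * (c * m')) ^ 4 * (-3 * A) := by rw [hI, hm']; push_cast; ring
    have hJ' : f.J = ((p : ℤ) * (c * m')) ^ 6 * (-27 * B) := by rw [hJ, hm']; push_cast; ring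
    obtain ⟨g, hK, hg, hgI, hgJ⟩ := exists_kEquiv_oddPrime h53 h54 hp hp2 hf hI' hJ'
    obtain ⟨g', hK', hg', hgI', hgJ'⟩ := ih m' hlt hm'odd g hg hgI hgJ
    exact ⟨g', hK.trans hK', hg', hgI', hgJ'⟩

/-- **Minimisation** (Bhargava–Shankar, held text, proof of Thm 5.6, p. 32, granted Lemmas 5.3,
5.4, 5.5 = hypotheses `h53`, `h54`, `h55`): a locally soluble integral binary quartic form with
invariants `λ⁴I(E)`, `λ⁶J(E)` for some `λ ∈ ℚˣ` (`E = E_{A,B}`, `I(E) = −3A`, `J(E) = −27B`) is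
equivalent to a locally soluble integral form with invariants exactly `2⁴I(E)`, `2⁶J(E)`: multiply
by the square of the denominator of `λ`, remove the odd primes of the numerator
(`exists_kEquiv_odd`), adjust the power of `2` (`exists_kEquiv_twoPow`).
[cite: BhargavaShankarAnnals2015, Thm 5.6 (proof, p. 32; arXiv:1006.1002v2 numbering)] -/
theorem exists_kEquiv_invariants (h53 : bsd_minimisation_prime_five_le)
    (h54 : bsd_minimisation_three) (h55 : bsd_minimisation_two) {A B : ℤ} {f : BinaryQuartic ℤ}
    (hf : f.IsLocallySoluble) {t : ℚ} (ht : t ≠ 0) (hI : (f.I : ℚ) = t ^ 4 * (-3 * A))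
    (hJ : (f.J : ℚ) = t ^ 6 * (-27 * B)) :
    ∃ f' : BinaryQuartic ℤ, KEquiv (f.map (Int.castRingHom ℚ)) (f'.map (Int.castRingHom ℚ)) ∧
      f'.IsLocallySoluble ∧ f'.I = 2 ^ 4 * (-3 * A) ∧ f'.J = 2 ^ 6 * (-27 * B) := by
  -- clear denominators: `f₁ = q² f` has invariants `n⁴I(E)`, `n⁶J(E)`, `t = n/q`
  set q : ℕ := t.den
  set n : ℤ := t.num
  have hq : (q : ℚ) ≠ 0 := by exact_mod_cast t.den_ne_zero
  have hn : n ≠ 0 := Rat.num_ne_zero.mpr ht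
  have htq : t * q = n := Rat.mul_den_eq_num t
  set f₁ : BinaryQuartic ℤ := ((q : ℤ) ^ 2) • f with hf₁_def
  have hK₁ : KEquiv (f.map (Int.castRingHom ℚ)) (f₁.map (Int.castRingHom ℚ)) := by
    refine ⟨q, hq, 1, by simp, ?_⟩
    rw [subst_one, hf₁_def, TwoCovering.map_smul_form, map_pow]
    congr 1
  have hf₁ : f₁.IsLocallySoluble := (KEquiv.isLocallySoluble_iff hK₁).mpr hf
  have hI₁ : (f₁.I : ℚ) = (n : ℚ) ^ 4 * (-3 * A) := by
    rw [hf₁_def, I_smul, ← htq]; push_cast; rw [hI]; ring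
  have hJ₁ : (f₁.J : ℚ) = (n : ℚ) ^ 6 * (-27 * B) := by
    rw [hf₁_def, J_smul, ← htq]; push_cast; rw [hJ]; ring
  have hI₁' : f₁.I = n ^ 4 * (-3 * A) := by exact_mod_cast hI₁
  have hJ₁' : f₁.J = n ^ 6 * (-27 * B) := by exact_mod_cast hJ₁
  -- only `|n| = 2^k m` (`m` odd) matters
  set u : ℕ := n.natAbs
  have hu : u ≠ 0 := Int.natAbs_ne_zero.mpr hn
  obtain ⟨k, m, hm, hkm⟩ := Nat.exists_eq_two_pow_mul_odd hu
  have hnu4 : n ^ 4 = (u : ℤ) ^ 4 := by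
    rw [Int.natCast_natAbs, Even.pow_abs ⟨2, rfl⟩]
  have hnu6 : n ^ 6 = (u : ℤ) ^ 6 := by
    rw [Int.natCast_natAbs, Even.pow_abs ⟨3, rfl⟩]
  have hI₂ : f₁.I = ((2 : ℤ) ^ k * m) ^ 4 * (-3 * A) := by
    rw [hI₁', hnu4, hkm]; push_cast; ring
  have hJ₂ : f₁.J = ((2 : ℤ) ^ k * m) ^ 6 * (-27 * B) := by
    rw [hJ₁', hnu6, hkm]; push_cast; ring
  -- odd part, then the power of two
  obtain ⟨g, hK₂, hg, hgI, hgJ⟩ := exists_kEquiv_odd h53 h54 A B ((2 : ℤ) ^ k) m hm f₁ hf₁ hI₂ hJ₂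
  obtain ⟨f', hK₃, hI', hJ'⟩ := exists_kEquiv_twoPow h55 A B k g hg hgI hgJ
  have hK : KEquiv (f.map (Int.castRingHom ℚ)) (f'.map (Int.castRingHom ℚ)) :=
    hK₁.trans (hK₂.trans hK₃)
  exact ⟨f', hK, (KEquiv.isLocallySoluble_iff hK).mpr hf, hI', hJ'⟩

end Minimisation

/-! ## §4 The class counts agree -/

section Counting

/-- **The counting step of the proof of Thm 5.6** (Bhargava–Shankar, held text p. 32), granted
Lemmas 5.3–5.5: for `(A, B)` with `4A³ + 27B² ≠ 0`, the number of equivalence classes of locally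
soluble integral forms with invariants `λ⁴I(E)`, `λ⁶J(E)` (`λ ∈ ℚˣ`) equals the number of
`PGL₂(ℚ)`-classes of locally soluble integral forms with invariants exactly `2⁴I(E)`, `2⁶J(E)`:
`T ↦ T ∩ S` is a bijection between the two sets of classes, by minimisation
(`exists_kEquiv_invariants`: every class meets `S`) and by §2 (on `S`, equivalence is
`PGL₂(ℚ)`-equivalence; `(I, J) ≠ (0, 0)` as `4A³ + 27B² ≠ 0`).
[cite: BhargavaShankarAnnals2015, Thm 5.6 (proof, p. 32; arXiv:1006.1002v2 numbering)] -/
theorem kEquivClassCount_eq_pgl2QClassCount (h53 : bsd_minimisation_prime_five_le)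
    (h54 : bsd_minimisation_three) (h55 : bsd_minimisation_two) {A B : ℤ}
    (hAB : 4 * A ^ 3 + 27 * B ^ 2 ≠ 0) :
    kEquivClassCount {f : BinaryQuartic ℤ | f.IsLocallySoluble ∧ ∃ t : ℚ, t ≠ 0 ∧
        (f.I : ℚ) = t ^ 4 * (-3 * A) ∧ (f.J : ℚ) = t ^ 6 * (-27 * B)} =
      pgl2QClassCount {f : BinaryQuartic ℤ | f.IsLocallySoluble ∧
        f.I = 2 ^ 4 * (-3 * A) ∧ f.J = 2 ^ 6 * (-27 * B)} := by
  set Sb : Set (BinaryQuartic ℤ) := {f | f.IsLocallySoluble ∧ ∃ t : ℚ, t ≠ 0 ∧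
    (f.I : ℚ) = t ^ 4 * (-3 * A) ∧ (f.J : ℚ) = t ^ 6 * (-27 * B)} with hSb
  set Ss : Set (BinaryQuartic ℤ) := {f | f.IsLocallySoluble ∧
    f.I = 2 ^ 4 * (-3 * A) ∧ f.J = 2 ^ 6 * (-27 * B)} with hSs
  -- the classes (traces on the two sets)
  set TK : BinaryQuartic ℤ → Set (BinaryQuartic ℤ) := fun f ↦
    {g | g ∈ Sb ∧ KEquiv (f.map (Int.castRingHom ℚ)) (g.map (Int.castRingHom ℚ))} with hTK
  set TP : BinaryQuartic ℤ → Set (BinaryQuartic ℤ) := fun f ↦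
    {g | g ∈ Ss ∧ PGL2Equiv (f.map (Int.castRingHom ℚ)) (g.map (Int.castRingHom ℚ))} with hTP
  change (TK '' Sb).ncard = (TP '' Ss).ncard
  -- `Ss ⊆ Sb` (`λ = 2`)
  have hsub : Ss ⊆ Sb := fun g hg ↦
    ⟨hg.1, 2, two_ne_zero, by rw [hg.2.1]; push_cast; ring, by rw [hg.2.2]; push_cast; ring⟩
  -- on `Ss` the invariants are fixed and not both zero
  have h0 : ∀ g ∈ Ss, (g.map (Int.castRingHom ℚ)).I ≠ 0 ∨ (g.map (Int.castRingHom ℚ)).J ≠ 0 := by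
    intro g hg
    rw [I_map, J_map, hg.2.1, hg.2.2]
    by_cases hA : A = 0
    · right
      have hB : B ≠ 0 := by rintro rfl; exact hAB (by rw [hA]; ring)
      simp only [eq_intCast, Int.cast_mul, Int.cast_pow, Int.cast_ofNat, Int.cast_neg, ne_eq]
      intro h
      exact hB (by exact_mod_cast (by nlinarith [h] : (B : ℚ) = 0))
    · left
      simp only [eq_intCast, Int.cast_mul, Int.cast_pow, Int.cast_ofNat, Int.cast_neg, ne_eq]
      intro h
      exact hA (by exact_mod_cast (by nlinarith [h] : (A : ℚ) = 0))
  have hinv : ∀ g₁ ∈ Ss, ∀ g₂ ∈ Ss,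
      KEquiv (g₁.map (Int.castRingHom ℚ)) (g₂.map (Int.castRingHom ℚ)) →
        PGL2Equiv (g₁.map (Int.castRingHom ℚ)) (g₂.map (Int.castRingHom ℚ)) := by
    intro g₁ hg₁ g₂ hg₂ h
    refine h.pgl2Equiv_of_I_eq_of_J_eq ?_ ?_ (h0 g₁ hg₁)
    · rw [I_map, I_map, hg₁.2.1, hg₂.2.1]
    · rw [J_map, J_map, hg₁.2.2, hg₂.2.2]
  -- every class of `Sb` meets `Ss` (minimisation)
  have hrep : ∀ f ∈ Sb, ∃ f' ∈ Ss,
      KEquiv (f.map (Int.castRingHom ℚ)) (f'.map (Int.castRingHom ℚ)) := by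
    rintro f ⟨hf, t, ht, hI, hJ⟩
    obtain ⟨f', hK, hf', hI', hJ'⟩ := exists_kEquiv_invariants h53 h54 h55 hf ht hI hJ
    exact ⟨f', ⟨hf', hI', hJ'⟩, hK⟩
  -- the trace on `Ss` of the class of `f` is the `PGL₂(ℚ)`-class of any representative in `Ss`
  have key : ∀ f ∈ Sb, ∀ f' ∈ Ss,
      KEquiv (f.map (Int.castRingHom ℚ)) (f'.map (Int.castRingHom ℚ)) → TK f ∩ Ss = TP f' := by
    intro f _ f' hf' hff'
    ext g
    constructor
    · rintro ⟨⟨-, hfg⟩, hgs⟩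
      exact ⟨hgs, hinv f' hf' g hgs ((TwoCovering.kEquiv_symm hff').trans hfg)⟩
    · rintro ⟨hgs, hf'g⟩
      exact ⟨⟨hsub hgs, hff'.trans hf'g.kEquiv⟩, hgs⟩
  -- `T ↦ T ∩ Ss` is injective on the classes of `Sb` …
  have hinj : Set.InjOn (fun T : Set (BinaryQuartic ℤ) ↦ T ∩ Ss) (TK '' Sb) := by
    rintro _ ⟨f₁, hf₁, rfl⟩ _ ⟨f₂, hf₂, rfl⟩ heq
    obtain ⟨f₁', hf₁', hK₁⟩ := hrep f₁ hf₁
    have hmem : f₁' ∈ TK f₁ ∩ Ss := ⟨⟨hsub hf₁', hK₁⟩, hf₁'⟩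
    have hmem₂ : f₁' ∈ TK f₂ ∩ Ss := by
      have heq' : TK f₁ ∩ Ss = TK f₂ ∩ Ss := heq
      rwa [heq'] at hmem
    obtain ⟨⟨-, hK₂⟩, -⟩ := hmem₂
    have h12 : KEquiv (f₁.map (Int.castRingHom ℚ)) (f₂.map (Int.castRingHom ℚ)) :=
      hK₁.trans (TwoCovering.kEquiv_symm hK₂)
    ext g
    exact ⟨fun ⟨hg, h⟩ ↦ ⟨hg, (TwoCovering.kEquiv_symm h12).trans h⟩,
      fun ⟨hg, h⟩ ↦ ⟨hg, h12.trans h⟩⟩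
  -- … and maps them onto the `PGL₂(ℚ)`-classes of `Ss`
  have himage : (fun T : Set (BinaryQuartic ℤ) ↦ T ∩ Ss) '' (TK '' Sb) = TP '' Ss := by
    ext T
    constructor
    · rintro ⟨_, ⟨f, hf, rfl⟩, rfl⟩
      obtain ⟨f', hf', hK⟩ := hrep f hf
      exact ⟨f', hf', (key f hf f' hf' hK).symm⟩
    · rintro ⟨f', hf', rfl⟩
      exact ⟨TK f', ⟨f', hsub hf', rfl⟩, key f' (hsub hf') f' hf' (KEquiv.refl _)⟩
  rw [← hinj.ncard_image, himage]

end Counting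

end BinaryQuartic

/-! ## §5 Theorem 5.6, Theorem 1.1 and Corollary 1.2 granted the printed inputs -/

section Assembly

open BinaryQuartic

/-- **Bhargava–Shankar, Theorem 5.6 (the `2`-Selmer parametrization), proved from its printed
inputs** (held arXiv text §5.1, p. 32): granted the Birch–Swinnerton-Dyer correspondence
(Lemma 5.2 with the remark on p. 31: `#S₂(E_{A,B})` = number of equivalence classes of locally
soluble integral quartics with invariants `λ⁴I(E)`, `λ⁶J(E)`, `λ ∈ ℚˣ`;
`bhargavaShankar_card_selmerTwo_eq_kEquivClassCount`, hypothesis `h52`) and the minimisation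
Lemmas 5.3, 5.4, 5.5 (`bsd_minimisation_prime_five_le`, `bsd_minimisation_three`,
`bsd_minimisation_two`; hypotheses `h53`–`h55`), the elements of `S₂(E_{A,B})` correspond to the
`PGL₂(ℚ)`-classes of locally soluble integral quartics with invariants `2⁴I(E)`, `2⁶J(E)`
(`Literature.NumberTheory.EllipticCurves.bhargavaShankar_card_selmerTwo_eq`).
[cite: BhargavaShankarAnnals2015, Thm 5.6 (arXiv:1006.1002v2 numbering; §5.1)] -/
theorem bhargavaShankar_card_selmerTwo_eq_of_facts
    (h52 : bhargavaShankar_card_selmerTwo_eq_kEquivClassCount)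
    (h53 : bsd_minimisation_prime_five_le) (h54 : bsd_minimisation_three)
    (h55 : bsd_minimisation_two) : bhargavaShankar_card_selmerTwo_eq := by
  intro AB hAB
  rw [h52 AB hAB]
  exact kEquivClassCount_eq_pgl2QClassCount h53 h54 h55 hAB.1

/-- **Bhargava–Shankar, Theorem 1.1, granted Lemma 5.2, Lemmas 5.3–5.5, eq. (31) (with Prop. 5.12,
Lemma 5.16) and Prop. 5.8 of the held arXiv text**: the average size of the `2`-Selmer group
over the curves of naive height `< X` tends to `3`
(`Literature.NumberTheory.EllipticCurves.average_card_selmerTwo`); Theorem 5.6 is now assembled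
(`bhargavaShankar_card_selmerTwo_eq_of_facts`) rather than assumed.
[cite: BhargavaShankarAnnals2015, Thm 1.1 (arXiv:1006.1002v2 numbering)] -/
theorem average_card_selmerTwo_of_BSD_facts
    (h52 : bhargavaShankar_card_selmerTwo_eq_kEquivClassCount)
    (h53 : bsd_minimisation_prime_five_le) (h54 : bsd_minimisation_three)
    (h55 : bsd_minimisation_two) (h31 : bhargavaShankar_sum_irredClassCount_asymptotic)
    (h58 : bhargavaShankar_sum_card_selmerTwo_twoTorsion_le) :
    EllipticCurves.average_card_selmerTwo :=
  EllipticCurves.average_card_selmerTwo_of_BS_facts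
    (bhargavaShankar_card_selmerTwo_eq_of_facts h52 h53 h54 h55) h31 h58

/-- **Bhargava–Shankar, Cor. 1.2 (`Literature.NumberTheory.EllipticCurves.averageRankLE_three_halves`),
granted Lemma 5.2, Lemmas 5.3–5.5 (= Birch–Swinnerton-Dyer 1963, Lemmas 3–5), eq. (31) and
Prop. 5.8 of the held arXiv text** — every other step of the paper (Thm 5.6 from these, Lemma 5.15,
Prop. 5.7, the identity class, §5.4, Thm 1.1 ⇒ Cor. 1.2 with Mordell–Weil and AEC X.4.2) being
proved in the tree: when elliptic curves over `ℚ` are ordered by naive height, the average rank is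
at most `3/2`. [cite: BhargavaShankarAnnals2015, Cor. 1.2] -/
theorem averageRankLE_three_halves_of_BSD_facts
    (h52 : bhargavaShankar_card_selmerTwo_eq_kEquivClassCount)
    (h53 : bsd_minimisation_prime_five_le) (h54 : bsd_minimisation_three)
    (h55 : bsd_minimisation_two) (h31 : bhargavaShankar_sum_irredClassCount_asymptotic)
    (h58 : bhargavaShankar_sum_card_selmerTwo_twoTorsion_le) :
    EllipticCurves.averageRankLE_three_halves :=
  EllipticCurves.averageRankLE_three_halves_of_BS_facts
    (bhargavaShankar_card_selmerTwo_eq_of_facts h52 h53 h54 h55) h31 h58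

end Assembly

/-! ## The Birch–Swinnerton-Dyer correspondence: discharge of
`bhargavaShankar_card_selmerTwo_eq_kEquivClassCount` -/

section SelmerCount

open BinaryQuartic WeierstrassCurve TwoCovering GaloisRepresentations

/-- `ℚ`-equivalence is reflexive. [folklore] -/
theorem TwoCovering.kEquiv_refl' (f : BinaryQuartic ℚ) : KEquiv f f :=
  ⟨1, one_ne_zero, 1, by simp, by simp⟩

/-- **The Birch–Swinnerton-Dyer correspondence, discharged** (Bhargava–Shankar 2015, Lemma 5.2 and
§5.1 p. 31 of the held arXiv text; Birch–Swinnerton-Dyer 1963, Lemma 1; Cremona 2001, Prop. 3.2 and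
§5): for `(A, B)` in the height family, the `ℚ`-equivalence classes of locally soluble integral binary
quartic forms with invariants `t⁴(−3A)`, `t⁶(−27B)` (`t ≠ 0`) are in bijection with the
cohomological `2`-Selmer group of `E_{A,B}`, via `f ↦ [σ ↦ T(r₀, σr₀)]` (files
`BinaryQuarticTwoCoverings*`: well defined and injective on classes — files IV–VI; lands in and
exhausts the Selmer group — files V, VII–XII); hence the two cardinalities agree.
[cite: BhargavaShankarAnnals2015, Lemma 5.2 and §5.1 p. 31 (arXiv:1006.1002v2 numbering)] -/
theorem bhargavaShankar_card_selmerTwo_eq_kEquivClassCount_holds :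
    bhargavaShankar_card_selmerTwo_eq_kEquivClassCount := by
  intro AB hAB
  have hE : 4 * AB.1 ^ 3 + 27 * AB.2 ^ 2 ≠ 0 := hAB.1
  change Nat.card ((shortWeierstrass AB).selmerGroup 2) = kEquivClassCount (selmerFormSet AB)
  -- the classes
  set cls : BinaryQuartic ℤ → Set (BinaryQuartic ℤ) := fun f ↦
    {g | g ∈ selmerFormSet AB ∧ KEquiv (f.map (Int.castRingHom ℚ)) (g.map (Int.castRingHom ℚ))} with hcls
  have hcls_eq : ∀ {f f' : BinaryQuartic ℤ}, f ∈ selmerFormSet AB → f' ∈ selmerFormSet AB →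
      (cls f = cls f' ↔ KEquiv (f.map (Int.castRingHom ℚ)) (f'.map (Int.castRingHom ℚ))) := by
    intro f f' hf hf'
    constructor
    · intro h
      have : f' ∈ cls f' := ⟨hf', TwoCovering.kEquiv_refl' _⟩
      rw [← h] at this
      exact this.2
    · intro h
      ext g
      simp only [hcls, Set.mem_setOf_eq]
      exact ⟨fun ⟨hg, hfg⟩ ↦ ⟨hg, kEquiv_trans (kEquiv_symm h) hfg⟩, fun ⟨hg, hfg⟩ ↦ ⟨hg, kEquiv_trans h hfg⟩⟩
  -- the map on classes
  let C : Set (Set (BinaryQuartic ℤ)) := cls '' selmerFormSet AB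
  have hrep : ∀ X : C, ∃ f, f ∈ selmerFormSet AB ∧ cls f = X.1 := fun X ↦ X.2
  choose rep hrep_mem hrep_eq using hrep
  let Ψ : C → (shortWeierstrass AB).selmerGroup 2 := fun X ↦
    ⟨selmerClassOf (hrep_mem X) hE, selmerClassOf_mem (hrep_mem X) hE⟩
  have hΨ : ∀ {f : BinaryQuartic ℤ} (hf : f ∈ selmerFormSet AB),
      (Ψ ⟨cls f, Set.mem_image_of_mem _ hf⟩ : galH1Torsion (shortWeierstrass AB) 2) = selmerClassOf hf hE := by
    intro f hf
    show selmerClassOf (hrep_mem ⟨cls f, _⟩) hE = selmerClassOf hf hE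
    apply selmerClassOf_eq_of_kEquiv
    exact (hcls_eq (hrep_mem _) hf).mp (hrep_eq ⟨cls f, Set.mem_image_of_mem _ hf⟩)
  have hbij : Function.Bijective Ψ := by
    constructor
    · intro X Y hXY
      apply Subtype.ext
      rw [← hrep_eq X, ← hrep_eq Y]
      apply (hcls_eq (hrep_mem X) (hrep_mem Y)).mpr
      exact kEquiv_of_selmerClassOf_eq (hrep_mem X) (hrep_mem Y) hE (congrArg Subtype.val hXY)
    · rintro ⟨c, hc⟩
      obtain ⟨f, hf, hfc⟩ := exists_selmerFormSet_of_mem hE hc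
      exact ⟨⟨cls f, Set.mem_image_of_mem _ hf⟩, Subtype.ext ((hΨ hf).trans hfc)⟩
  rw [kEquivClassCount, ← Nat.card_congr (Equiv.ofBijective Ψ hbij), Nat.card_coe_set_eq]

end SelmerCount


end Literature.NumberTheory.EllipticCurves

end
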